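import Summits.BirchSwinnertonDyer.Rank1Residual.WAll.TargetAdditiveAtThreeCells
import Summits.BirchSwinnertonDyer.BirchSwinnertonDyer.Theorems.SchneiderFreeAdditiveX3Defs
import Summits.BirchSwinnertonDyer.Rank1Residual.X11b.AnticyclotomicSelmerDual
import Summits.BirchSwinnertonDyer.Rank1Residual.X11b.CharIdealTrivialCharacter
import Literature.NumberTheory.EllipticCurves.UnrIntegersUnits
import HarnessLib

/-!
# Crux E `WildSplitEisensteinInclusionAtThree` (stmt-BirchSwinnertonDyer-20479): the RANK-ONE CONSTANT-TERM PINCH —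
# on every frame with `L(𝟙) ≠ 0`, the Kolyvagin inclusion (UTD 20395's conclusion) and the value-at-𝟙 residual
# `E_𝟙` (w3, `…ValueAtOne`) already give the full `Λ`-adic EQUALITY `Ch_Λ(X_(∅,0))·R₀⟦T⟧ = (L)`, hence E
# (cell `pub/bsd-wall`, lead seat `bsd-wall-soed-p1` g5, `--supports 20479`, helper; line `birth` is dead ×3 and
# is not touched here)

WHAT THIS FILE SAYS (pure algebra over `R₀⟦T⟧`, then bookkeeping under the crux's binders; nothing asserted):

* §1 (every prime `p`) `span_map_eq_span_of_span_le_of_norm_constantCoeff_le` — for `f ∈ Λ = ℤ_p⟦T⟧` and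
  `L ∈ R₀⟦T⟧`: if `(L) ⊆ (ι f)` (the KOLYVAGIN direction at the instance), `‖f(0)‖ ≤ ‖L(0)‖` (the
  value-at-𝟙 residual `E_𝟙` of the EISENSTEIN direction) and `L(0) ≠ 0`, then `(ι f) = (L)`: writing
  `L = h·ι f`, `‖L(0)‖ = ‖h(0)‖·‖f(0)‖ ≤ ‖f(0)‖ ≤ ‖L(0)‖ ≠ 0` forces `‖h(0)‖ = 1`, so `h(0) ∈ R₀ˣ` and
  `h ∈ R₀⟦T⟧ˣ` (the integral constant-term pinch of `KatoHalfPinch.span_eq_span_of_mem_span_of_norm_constantCoeff_eq`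
  over `Λ`, here over `R₀⟦T⟧` and with the norm equality weakened to the inequality the divisibility upgrades).
* §2 (every `p`, every `(E, κ, 𝔮, Σ, γ)`) `charIdeal_map_eq_span_of_kolyvagin_of_valueAtOne` — the same for the
  crux's ideal `Ch_Λ(X_ac^Σ)·R₀⟦T⟧` (principal: Literature `charIdeal_isPrincipal_holds`).
* §3 (`p = 3`, crux binders VERBATIM) `imcEqualityOffZero_of_kolyvaginInclusion_of_valueAtOne` /
  `cruxOffZero_of_kolyvaginInclusion_of_valueAtOne` — from the signature of route UTD's crux
  `AdditiveSplitIMCInclusionAtThree` (stmt-BirchSwinnertonDyer-20395) displayed as `hKo` and the value-at-𝟙 residual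
  `E_𝟙` displayed as `hE1` (the conclusion shape of `…ValueAtOne.valueAtOne_of_wildSplitEisensteinInclusionAtThree`):
  at every instance of crux E's binders (torsion guard included) with `L(𝟙) ≠ 0`, the EQUALITY
  `Ch_Λ(X_(∅,0))·R₀⟦T⟧ = (L)` and in particular E's conclusion.

READING (planning fact, complements `…ValueAtOne` §2 «E ⟹ E_𝟙» and `…LeverCurrency` §3 «E ⟸ Kolyvagin inclusion +
λ-dominance»): MODULO UTD 20395, crux E and its bottom-layer residual `E_𝟙` («`#Ш(E/K)[3^∞]·∏c_w·c² ≥ [E(K):ℤP]²`-shape,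
the lower bound on Ш by the Heegner index») are EQUIVALENT at every frame whose value at the trivial character is
non-zero — exactly the frames the kernel `EisensteinKernelAtThree` visits (there `L(𝟙) = u·(log_ω P/c)²`, `P`
non-torsion, crux `WildSplitWaldspurgerAtThree`). At frames with `L(𝟙) = 0` (a Heegner field `K` with
`r_an(E^(d_K)) ≥ 2` is allowed by E's binders) the pinch is silent and E keeps genuinely `Λ`-adic content; no
`λ`/`μ`-input is used anywhere (contrast `…LeverCurrency.WildSplitEisensteinInclusionAtThree_of_kolyvaginInclusion_of_dominance`).

HONEST STATUS: no progress on E itself — `hKo` (UTD's wall 20395) and `hE1` are antecedents, nothing is asserted about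
either; no definition, no named fact, no `sorry`; BSD is not proved for any curve. Supports, does not close,
stmt-BirchSwinnertonDyer-20479.

References: [Washington1997] §7.1 (units of `𝒪⟦T⟧` = series with unit constant term); [GreenbergVatsal2000] p. 4
(after Thm. (1.2): equal invariants + one divisibility ⟹ equal ideals — here the degree-`0` instance);
[JetchevSkinnerWan2017] §7.4.1 (arXiv:1512.06894 p. 30: the kernel reads both halves at `𝟙` only); folklore.
-/

noncomputable section

open scoped Classical

set_option linter.dupNamespace false
set_option autoImplicit false

namespace Summit.BirchSwinnertonDyer.BirchSwinnertonDyer.Theorems.WildSplitEisensteinInclusionAtThreeValueAtOnePinch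

open NumberField IsDedekindDomain Field PowerSeries
  Literature.NumberTheory.EllipticCurves
  Summit.BirchSwinnertonDyer.Rank1Residual.X11b
  Summit.BirchSwinnertonDyer.Rank1Residual.X11b.AcSelmer
  Summit.BirchSwinnertonDyer.Rank1Residual.X11b.Halves
  Summit.BirchSwinnertonDyer.BirchSwinnertonDyer.Theorems

/-! ### §1 The constant-term pinch over `R₀⟦T⟧` (every prime `p`) -/

section Algebra

variable (p : ℕ) [Fact p.Prime]

/-- The constant term of `ι f ∈ R₀⟦T⟧` (`ι : ℤ_p → R₀`), read in `ℂ_p`, has the norm of `f(0) ∈ ℤ_p ⊂ ℚ_p`.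
[folklore] -/
theorem norm_constantCoeff_map_toUnr (f : IwasawaAlgebra p) :
    ‖((constantCoeff (PowerSeries.map (toUnr p) f) : unrIntegers p) : ℂ_[p])‖ =
      ‖((constantCoeff f : ℤ_[p]) : ℚ_[p])‖ := by
  rw [CongruenceLimit.constantCoeff_map_apply (toUnr p) f, coe_toUnr, norm_algebraMap']

/-- **The rank-one constant-term pinch (pure algebra).** In `R₀⟦T⟧`: if `(L) ⊆ (ι f)` (Kolyvagin direction),
`‖f(0)‖ ≤ ‖L(0)‖` (Eisenstein direction read at `T = 0` only) and `L(0) ≠ 0`, then `(ι f) = (L)`. Proof: `L = h·ι f`,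
so `‖L(0)‖ = ‖h(0)‖·‖f(0)‖`; with `‖f(0)‖ ≤ ‖L(0)‖` and `L(0) ≠ 0` this gives `1 ≤ ‖h(0)‖ ≤ 1`, so `h(0)` is a unit
of `R₀` (`unrIntegers.isUnit_iff_norm_eq_one`) and `h` a unit of `R₀⟦T⟧` (`PowerSeries.isUnit_iff_constantCoeff`).
[cite: Washington1997, §7.1] [cite: GreenbergVatsal2000, p. 4 (after Thm. (1.2))] -/
theorem span_map_eq_span_of_span_le_of_norm_constantCoeff_le {f : IwasawaAlgebra p} {L : UnrSeries p}
    (hKo : Ideal.span ({L} : Set (UnrSeries p)) ≤ Ideal.span {PowerSeries.map (toUnr p) f})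
    (hE1 : ‖((constantCoeff f : ℤ_[p]) : ℚ_[p])‖ ≤ ‖((constantCoeff L : unrIntegers p) : ℂ_[p])‖)
    (hL0 : constantCoeff L ≠ 0) :
    Ideal.span ({PowerSeries.map (toUnr p) f} : Set (UnrSeries p)) = Ideal.span {L} := by
  obtain ⟨h, hh⟩ := Ideal.mem_span_singleton'.mp ((Ideal.span_singleton_le_iff_mem _).mp hKo)
  have hL0' : ((constantCoeff L : unrIntegers p) : ℂ_[p]) ≠ 0 :=
    fun h0 => hL0 (ZeroMemClass.coe_eq_zero.mp h0)
  have hfac : ((constantCoeff L : unrIntegers p) : ℂ_[p]) =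
      ((constantCoeff h : unrIntegers p) : ℂ_[p]) *
        ((constantCoeff (PowerSeries.map (toUnr p) f) : unrIntegers p) : ℂ_[p]) := by
    rw [← hh, map_mul, Subring.coe_mul]
  have hg0 : ((constantCoeff (PowerSeries.map (toUnr p) f) : unrIntegers p) : ℂ_[p]) ≠ 0 :=
    fun h0 => hL0' (by rw [hfac, h0, mul_zero])
  have hgpos : 0 < ‖((constantCoeff (PowerSeries.map (toUnr p) f) : unrIntegers p) : ℂ_[p])‖ :=
    norm_pos_iff.mpr hg0
  have hle : 1 * ‖((constantCoeff (PowerSeries.map (toUnr p) f) : unrIntegers p) : ℂ_[p])‖ ≤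
      ‖((constantCoeff h : unrIntegers p) : ℂ_[p])‖ *
        ‖((constantCoeff (PowerSeries.map (toUnr p) f) : unrIntegers p) : ℂ_[p])‖ := by
    rw [one_mul, ← norm_mul, ← hfac, norm_constantCoeff_map_toUnr]
    exact hE1
  have h1 : 1 ≤ ‖((constantCoeff h : unrIntegers p) : ℂ_[p])‖ := le_of_mul_le_mul_right hle hgpos
  have hnorm : ‖((constantCoeff h : unrIntegers p) : ℂ_[p])‖ = 1 :=
    le_antisymm (norm_coe_unrIntegers_le_one p _) h1
  have hu : IsUnit h :=
    (PowerSeries.isUnit_iff_constantCoeff (φ := h)).mpr ((unrIntegers.isUnit_iff_norm_eq_one _).mpr hnorm)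
  rw [← hh]
  exact (Ideal.span_singleton_mul_left_unit hu _).symm

/-- The pinch in inclusion form: under the same hypotheses `(ι f) ⊆ (L)` (E's direction at the instance).
[cite: Washington1997, §7.1] -/
theorem span_map_le_span_of_span_le_of_norm_constantCoeff_le {f : IwasawaAlgebra p} {L : UnrSeries p}
    (hKo : Ideal.span ({L} : Set (UnrSeries p)) ≤ Ideal.span {PowerSeries.map (toUnr p) f})
    (hE1 : ‖((constantCoeff f : ℤ_[p]) : ℚ_[p])‖ ≤ ‖((constantCoeff L : unrIntegers p) : ℂ_[p])‖)
    (hL0 : constantCoeff L ≠ 0) :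
    Ideal.span ({PowerSeries.map (toUnr p) f} : Set (UnrSeries p)) ≤ Ideal.span {L} :=
  (span_map_eq_span_of_span_le_of_norm_constantCoeff_le p hKo hE1 hL0).le

end Algebra

/-! ### §2 The pinch for the crux's ideal `Ch_Λ(X_ac^Σ)·R₀⟦T⟧` (every `p`, every instance) -/

section Curve

variable (p : ℕ) [Fact p.Prime] {K : Type} [Field K] [NumberField K] (E : WeierstrassCurve K)
  (κ : ZpExtension K p) (𝔮 : HeightOneSpectrum (𝓞 K)) (Sg : Set (HeightOneSpectrum (𝓞 K)))
  (γ : absoluteGaloisGroup K) [Fact (κ.IsTopGenerator γ)]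

/-- **Kolyvagin inclusion + `E_𝟙` + `L(𝟙) ≠ 0` ⟹ the main-conjecture EQUALITY at the instance.** For the
`Λ`-module `X = X_ac^Σ(E[p^∞])` (any `E/K`, `κ`, `𝔮`, `Σ`, `γ`) and any `L ∈ R₀⟦T⟧`: if `(L) ⊆ Ch_Λ(X)·R₀⟦T⟧`, every
generator `f` of `Ch_Λ(X)` has `‖f(0)‖ ≤ ‖L(0)‖`, and `L(0) ≠ 0`, then `Ch_Λ(X)·R₀⟦T⟧ = (L)` (`Ch_Λ(X)` is principal,
Literature `charIdeal_isPrincipal_holds`; then §1). [cite: Washington1997, §7.1 and §13.2] -/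
theorem charIdeal_map_eq_span_of_kolyvagin_of_valueAtOne {L : UnrSeries p}
    (hKo : Ideal.span {L} ≤ (XAc.charIdeal E p κ 𝔮 Sg γ).map (PowerSeries.map (toUnr p)))
    (hE1 : ∀ f : IwasawaAlgebra p, XAc.charIdeal E p κ 𝔮 Sg γ = Ideal.span {f} →
      ‖((constantCoeff f : ℤ_[p]) : ℚ_[p])‖ ≤ ‖((constantCoeff L : unrIntegers p) : ℂ_[p])‖)
    (hL0 : constantCoeff L ≠ 0) :
    (XAc.charIdeal E p κ 𝔮 Sg γ).map (PowerSeries.map (toUnr p)) = Ideal.span {L} := by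
  have hP : (XAc.charIdeal E p κ 𝔮 Sg γ).IsPrincipal := charIdeal_isPrincipal_holds p (XAc E p κ 𝔮 Sg γ)
  obtain ⟨f, hf⟩ := hP
  rw [Ideal.submodule_span_eq] at hf
  have hmap : (XAc.charIdeal E p κ 𝔮 Sg γ).map (PowerSeries.map (toUnr p)) =
      Ideal.span {PowerSeries.map (toUnr p) f} := by
    rw [hf, CongruenceLimit.map_span_singleton_powerSeries]
  rw [hmap] at hKo ⊢
  exact span_map_eq_span_of_span_le_of_norm_constantCoeff_le p hKo (hE1 f hf) hL0

/-- The same in inclusion form: E's conclusion at the instance. [cite: Washington1997, §7.1 and §13.2] -/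
theorem charIdeal_map_le_span_of_kolyvagin_of_valueAtOne {L : UnrSeries p}
    (hKo : Ideal.span {L} ≤ (XAc.charIdeal E p κ 𝔮 Sg γ).map (PowerSeries.map (toUnr p)))
    (hE1 : ∀ f : IwasawaAlgebra p, XAc.charIdeal E p κ 𝔮 Sg γ = Ideal.span {f} →
      ‖((constantCoeff f : ℤ_[p]) : ℚ_[p])‖ ≤ ‖((constantCoeff L : unrIntegers p) : ℂ_[p])‖)
    (hL0 : constantCoeff L ≠ 0) :
    (XAc.charIdeal E p κ 𝔮 Sg γ).map (PowerSeries.map (toUnr p)) ≤ Ideal.span {L} :=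
  (charIdeal_map_eq_span_of_kolyvagin_of_valueAtOne p E κ 𝔮 Sg γ hKo hE1 hL0).le

end Curve

/-! ### §3 Under crux E's binders: UTD's inclusion + `E_𝟙` ⟹ E (indeed the equality) off `L(𝟙) = 0` -/

/-- **Crux E's EQUALITY form off `L(𝟙) = 0`, from the Kolyvagin inclusion and the value-at-𝟙 residual.** Hypotheses,
both DISPLAYED (no route file of UTD is imported, no new definition): `hKo` = the signature of route UTD's crux
`AdditiveSplitIMCInclusionAtThree` (stmt-BirchSwinnertonDyer-20395) verbatim — every frame `L` lies in
`Ch_Λ(X_(∅,0))·R₀⟦T⟧`; `hE1` = the value-at-𝟙 residual `E_𝟙` of crux E (the conclusion shape of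
`WildSplitEisensteinInclusionAtThreeValueAtOne.valueAtOne_of_wildSplitEisensteinInclusionAtThree`) verbatim. Conclusion:
at every instance of crux E's binders and torsion guard with, in addition, `L(𝟙) ≠ 0` (`PowerSeries.constantCoeff L ≠ 0`),
the EQUALITY `Ch_Λ(X_(∅,0))·R₀⟦T⟧ = (L)`. Nothing is asserted about `hKo` or `hE1`; BSD is not proved by this.
[cite: Washington1997, §7.1 and §13.2] [cite: GreenbergVatsal2000, p. 4 (after Thm. (1.2))] -/
theorem imcEqualityOffZero_of_kolyvaginInclusion_of_valueAtOne
    (hKo : ∀ (W : WeierstrassCurve ℚ) [W.IsElliptic] [W.IsGloballyMinimal] (N : ℕ) [NeZero N] (K : Type) [Field K] [NumberField K] (Dt : Literature.NumberTheory.EllipticCurves.ModularForms.ModularParametrizationData W N), Summit.BirchSwinnertonDyer.Rank1Residual.Additive.ClassO6 W 3 → W.HasSurjectiveModNGaloisRep 3 → W.analyticRank = 1 → W.conductorNorm ℤ = N → Literature.NumberTheory.EllipticCurves.IsImaginaryQuadratic K → Literature.NumberTheory.EllipticCurves.SatisfiesHeegnerHypothesis N K → ∀ (κ : Literature.NumberTheory.EllipticCurves.ZpExtension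 K 3), κ.IsAnticyclotomic → ∀ (γ : Field.absoluteGaloisGroup K) [Fact (κ.IsTopGenerator γ)] (𝔭 : IsDedekindDomain.HeightOneSpectrum (NumberField.RingOfIntegers K)), ((3 : ℕ) : NumberField.RingOfIntegers K) ∈ 𝔭.asIdeal → 𝔭.asIdeal.ramificationIdx (NumberField.RingOfIntegers ℚ) = 1 → 𝔭.asIdeal.inertiaDeg (NumberField.RingOfIntegers ℚ) = 1 → ∀ (𝔭' : IsDedekindDomain.HeightOneSpectrum (NumberField.RingOfIntegers K)), ((3 : ℕ) : NumberField.RingOfIntegers K) ∈ 𝔭'.asIdeal → 𝔭' ≠ 𝔭 → ∀ (ι' : PadicAlgCl 3 ≃+* ℂ), Summit.BirchSwinnertonDyer.BirchSwinnertonDyer.Theorems.SchneiderFree.BranchInducesPrime 3 ι' 𝔭 → ∀ (ΩK : ℂ) (Ωp : ℂ_[3]) (L : Literature.NumberTheory.EllipticCurves.UnrSeries 3), ΩK ≠ 0 → Ωp ≠ 0 → Literature.NumberTheory.EllipticCurves.IsBDPLFunction ι' 𝔭 κ γ Dt.f ΩK Ωp L → Ideal.span {L} ≤ (Summit.BirchSwinnertonDyer.Rank1Residual.X11b.AcSelmer.XAc.charIdeal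 (W.baseChange K) 3 κ 𝔭' ∅ γ).map (PowerSeries.map (Summit.BirchSwinnertonDyer.Rank1Residual.X11b.Halves.toUnr 3)))
    (hE1 : ∀ (W : WeierstrassCurve ℚ) [W.IsElliptic] [W.IsGloballyMinimal] (N : ℕ) [NeZero N] (K : Type) [Field K] [NumberField K] (Dt : Literature.NumberTheory.EllipticCurves.ModularForms.ModularParametrizationData W N), Summit.BirchSwinnertonDyer.Rank1Residual.Additive.ClassO6 W 3 → W.HasSurjectiveModNGaloisRep 3 → W.analyticRank = 1 → W.conductorNorm ℤ = N → Literature.NumberTheory.EllipticCurves.IsImaginaryQuadratic K → Literature.NumberTheory.EllipticCurves.SatisfiesHeegnerHypothesis N K → ∀ (κ : Literature.NumberTheory.EllipticCurves.ZpExtension K 3), κ.IsAnticyclotomic → ∀ (γ : Field.absoluteGaloisGroup K) [Fact (κ.IsTopGenerator γ)] (𝔭 : IsDedekindDomain.HeightOneSpectrum (NumberField.RingOfIntegers K)), ((3 : ℕ) : NumberField.RingOfIntegers K) ∈ 𝔭.asIdeal → 𝔭.asIdeal.ramificationIdx (NumberField.RingOfIntegers ℚ) = 1 → 𝔭.asIdeal.inertiaDeg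 (NumberField.RingOfIntegers ℚ) = 1 → ∀ (𝔭' : IsDedekindDomain.HeightOneSpectrum (NumberField.RingOfIntegers K)), ((3 : ℕ) : NumberField.RingOfIntegers K) ∈ 𝔭'.asIdeal → 𝔭' ≠ 𝔭 → ∀ (ι' : PadicAlgCl 3 ≃+* ℂ), Summit.BirchSwinnertonDyer.BirchSwinnertonDyer.Theorems.SchneiderFree.BranchInducesPrime 3 ι' 𝔭 → ∀ (ΩK : ℂ) (Ωp : ℂ_[3]) (L : Literature.NumberTheory.EllipticCurves.UnrSeries 3), ΩK ≠ 0 → Ωp ≠ 0 → Literature.NumberTheory.EllipticCurves.IsBDPLFunction ι' 𝔭 κ γ Dt.f ΩK Ωp L → Module.IsTorsion (Literature.NumberTheory.EllipticCurves.IwasawaAlgebra 3) (Summit.BirchSwinnertonDyer.Rank1Residual.X11b.AcSelmer.XAc (W.baseChange K) 3 κ 𝔭' ∅ γ) → ∀ (f : Literature.NumberTheory.EllipticCurves.IwasawaAlgebra 3), Summit.BirchSwinnertonDyer.Rank1Residual.X11b.AcSelmer.XAc.charIdeal (W.baseChange K) 3 κ 𝔭' ∅ γ = Ideal.span {f} →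 ‖((PowerSeries.constantCoeff f : ℤ_[3]) : ℚ_[3])‖ ≤ ‖((PowerSeries.constantCoeff L : Literature.NumberTheory.EllipticCurves.unrIntegers 3) : ℂ_[3])‖) :
    ∀ (W : WeierstrassCurve ℚ) [W.IsElliptic] [W.IsGloballyMinimal] (N : ℕ) [NeZero N] (K : Type) [Field K] [NumberField K] (Dt : Literature.NumberTheory.EllipticCurves.ModularForms.ModularParametrizationData W N), Summit.BirchSwinnertonDyer.Rank1Residual.Additive.ClassO6 W 3 → W.HasSurjectiveModNGaloisRep 3 → W.analyticRank = 1 → W.conductorNorm ℤ = N → Literature.NumberTheory.EllipticCurves.IsImaginaryQuadratic K → Literature.NumberTheory.EllipticCurves.SatisfiesHeegnerHypothesis N K → ∀ (κ : Literature.NumberTheory.EllipticCurves.ZpExtension K 3), κ.IsAnticyclotomic → ∀ (γ : Field.absoluteGaloisGroup K) [Fact (κ.IsTopGenerator γ)] (𝔭 : IsDedekindDomain.HeightOneSpectrum (NumberField.RingOfIntegers K)), ((3 : ℕ) : NumberField.RingOfIntegers K) ∈ 𝔭.asIdeal → 𝔭.asIdeal.ramificationIdx (NumberField.RingOfIntegers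 ℚ) = 1 → 𝔭.asIdeal.inertiaDeg (NumberField.RingOfIntegers ℚ) = 1 → ∀ (𝔭' : IsDedekindDomain.HeightOneSpectrum (NumberField.RingOfIntegers K)), ((3 : ℕ) : NumberField.RingOfIntegers K) ∈ 𝔭'.asIdeal → 𝔭' ≠ 𝔭 → ∀ (ι' : PadicAlgCl 3 ≃+* ℂ), Summit.BirchSwinnertonDyer.BirchSwinnertonDyer.Theorems.SchneiderFree.BranchInducesPrime 3 ι' 𝔭 → ∀ (ΩK : ℂ) (Ωp : ℂ_[3]) (L : Literature.NumberTheory.EllipticCurves.UnrSeries 3), ΩK ≠ 0 → Ωp ≠ 0 → Literature.NumberTheory.EllipticCurves.IsBDPLFunction ι' 𝔭 κ γ Dt.f ΩK Ωp L → Module.IsTorsion (Literature.NumberTheory.EllipticCurves.IwasawaAlgebra 3) (Summit.BirchSwinnertonDyer.Rank1Residual.X11b.AcSelmer.XAc (W.baseChange K) 3 κ 𝔭' ∅ γ) → PowerSeries.constantCoeff L ≠ 0 → (Summit.BirchSwinnertonDyer.Rank1Residual.X11b.AcSelmer.XAc.charIdeal (W.baseChange K) 3 κ 𝔭' ∅ γ).map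 (PowerSeries.map (Summit.BirchSwinnertonDyer.Rank1Residual.X11b.Halves.toUnr 3)) = Ideal.span {L} := by
  intro W _ _ N _ K _ _ Dt hO6 hsurj hr1 hN hK hH κ hκ γ _ 𝔭 h𝔭 he hf 𝔭' h𝔭' hne ι' hι ΩK Ωp L hΩK hΩp hL htor hL0
  exact charIdeal_map_eq_span_of_kolyvagin_of_valueAtOne 3 (W.baseChange K) κ 𝔭' ∅ γ
    (hKo W N K Dt hO6 hsurj hr1 hN hK hH κ hκ γ 𝔭 h𝔭 he hf 𝔭' h𝔭' hne ι' hι ΩK Ωp L hΩK hΩp hL)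
    (hE1 W N K Dt hO6 hsurj hr1 hN hK hH κ hκ γ 𝔭 h𝔭 he hf 𝔭' h𝔭' hne ι' hι ΩK Ωp L hΩK hΩp hL htor) hL0

/-- **Crux E off `L(𝟙) = 0`, from the Kolyvagin inclusion and the value-at-𝟙 residual** — crux E's signature
VERBATIM with the single extra antecedent `PowerSeries.constantCoeff L ≠ 0` inserted before its conclusion, from the
displayed `hKo` (UTD 20395's signature) and `hE1` (`E_𝟙`). With `…ValueAtOne` §2 («E ⟹ E_𝟙»): modulo UTD 20395,
E and `E_𝟙` coincide on every frame with `L(𝟙) ≠ 0`. Nothing is asserted about `hKo` or `hE1`; this does NOT prove E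
(frames with `L(𝟙) = 0` are outside) and BSD is not proved by this.
[cite: Washington1997, §7.1 and §13.2] [cite: JetchevSkinnerWan2017, §7.4.1 (arXiv:1512.06894 p. 30)] -/
theorem cruxOffZero_of_kolyvaginInclusion_of_valueAtOne
    (hKo : ∀ (W : WeierstrassCurve ℚ) [W.IsElliptic] [W.IsGloballyMinimal] (N : ℕ) [NeZero N] (K : Type) [Field K] [NumberField K] (Dt : Literature.NumberTheory.EllipticCurves.ModularForms.ModularParametrizationData W N), Summit.BirchSwinnertonDyer.Rank1Residual.Additive.ClassO6 W 3 → W.HasSurjectiveModNGaloisRep 3 → W.analyticRank = 1 → W.conductorNorm ℤ = N → Literature.NumberTheory.EllipticCurves.IsImaginaryQuadratic K → Literature.NumberTheory.EllipticCurves.SatisfiesHeegnerHypothesis N K → ∀ (κ : Literature.NumberTheory.EllipticCurves.ZpExtension K 3), κ.IsAnticyclotomic → ∀ (γ : Field.absoluteGaloisGroup K) [Fact (κ.IsTopGenerator γ)] (𝔭 : IsDedekindDomain.HeightOneSpectrum (NumberField.RingOfIntegers K)), ((3 : ℕ) : NumberField.RingOfIntegers K) ∈ 𝔭.asIdeal →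 𝔭.asIdeal.ramificationIdx (NumberField.RingOfIntegers ℚ) = 1 → 𝔭.asIdeal.inertiaDeg (NumberField.RingOfIntegers ℚ) = 1 → ∀ (𝔭' : IsDedekindDomain.HeightOneSpectrum (NumberField.RingOfIntegers K)), ((3 : ℕ) : NumberField.RingOfIntegers K) ∈ 𝔭'.asIdeal → 𝔭' ≠ 𝔭 → ∀ (ι' : PadicAlgCl 3 ≃+* ℂ), Summit.BirchSwinnertonDyer.BirchSwinnertonDyer.Theorems.SchneiderFree.BranchInducesPrime 3 ι' 𝔭 → ∀ (ΩK : ℂ) (Ωp : ℂ_[3]) (L : Literature.NumberTheory.EllipticCurves.UnrSeries 3), ΩK ≠ 0 → Ωp ≠ 0 → Literature.NumberTheory.EllipticCurves.IsBDPLFunction ι' 𝔭 κ γ Dt.f ΩK Ωp L → Ideal.span {L} ≤ (Summit.BirchSwinnertonDyer.Rank1Residual.X11b.AcSelmer.XAc.charIdeal (W.baseChange K) 3 κ 𝔭' ∅ γ).map (PowerSeries.map (Summit.BirchSwinnertonDyer.Rank1Residual.X11b.Halves.toUnr 3)))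
    (hE1 : ∀ (W : WeierstrassCurve ℚ) [W.IsElliptic] [W.IsGloballyMinimal] (N : ℕ) [NeZero N] (K : Type) [Field K] [NumberField K] (Dt : Literature.NumberTheory.EllipticCurves.ModularForms.ModularParametrizationData W N), Summit.BirchSwinnertonDyer.Rank1Residual.Additive.ClassO6 W 3 → W.HasSurjectiveModNGaloisRep 3 → W.analyticRank = 1 → W.conductorNorm ℤ = N → Literature.NumberTheory.EllipticCurves.IsImaginaryQuadratic K → Literature.NumberTheory.EllipticCurves.SatisfiesHeegnerHypothesis N K → ∀ (κ : Literature.NumberTheory.EllipticCurves.ZpExtension K 3), κ.IsAnticyclotomic → ∀ (γ : Field.absoluteGaloisGroup K) [Fact (κ.IsTopGenerator γ)] (𝔭 : IsDedekindDomain.HeightOneSpectrum (NumberField.RingOfIntegers K)), ((3 : ℕ) : NumberField.RingOfIntegers K) ∈ 𝔭.asIdeal → 𝔭.asIdeal.ramificationIdx (NumberField.RingOfIntegers ℚ) = 1 → 𝔭.asIdeal.inertiaDeg (NumberField.RingOfIntegers ℚ) = 1 → ∀ (𝔭' : IsDedekindDomain.HeightOneSpectrum (NumberField.RingOfIntegers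 K)), ((3 : ℕ) : NumberField.RingOfIntegers K) ∈ 𝔭'.asIdeal → 𝔭' ≠ 𝔭 → ∀ (ι' : PadicAlgCl 3 ≃+* ℂ), Summit.BirchSwinnertonDyer.BirchSwinnertonDyer.Theorems.SchneiderFree.BranchInducesPrime 3 ι' 𝔭 → ∀ (ΩK : ℂ) (Ωp : ℂ_[3]) (L : Literature.NumberTheory.EllipticCurves.UnrSeries 3), ΩK ≠ 0 → Ωp ≠ 0 → Literature.NumberTheory.EllipticCurves.IsBDPLFunction ι' 𝔭 κ γ Dt.f ΩK Ωp L → Module.IsTorsion (Literature.NumberTheory.EllipticCurves.IwasawaAlgebra 3) (Summit.BirchSwinnertonDyer.Rank1Residual.X11b.AcSelmer.XAc (W.baseChange K) 3 κ 𝔭' ∅ γ) → ∀ (f : Literature.NumberTheory.EllipticCurves.IwasawaAlgebra 3), Summit.BirchSwinnertonDyer.Rank1Residual.X11b.AcSelmer.XAc.charIdeal (W.baseChange K) 3 κ 𝔭' ∅ γ = Ideal.span {f} → ‖((PowerSeries.constantCoeff f : ℤ_[3]) : ℚ_[3])‖ ≤ ‖((PowerSeries.constantCoeff L : Literature.NumberTheory.EllipticCurves.unrIntegers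 3) : ℂ_[3])‖) :
    ∀ (W : WeierstrassCurve ℚ) [W.IsElliptic] [W.IsGloballyMinimal] (N : ℕ) [NeZero N] (K : Type) [Field K] [NumberField K] (Dt : Literature.NumberTheory.EllipticCurves.ModularForms.ModularParametrizationData W N), Summit.BirchSwinnertonDyer.Rank1Residual.Additive.ClassO6 W 3 → W.HasSurjectiveModNGaloisRep 3 → W.analyticRank = 1 → W.conductorNorm ℤ = N → Literature.NumberTheory.EllipticCurves.IsImaginaryQuadratic K → Literature.NumberTheory.EllipticCurves.SatisfiesHeegnerHypothesis N K → ∀ (κ : Literature.NumberTheory.EllipticCurves.ZpExtension K 3), κ.IsAnticyclotomic → ∀ (γ : Field.absoluteGaloisGroup K) [Fact (κ.IsTopGenerator γ)] (𝔭 : IsDedekindDomain.HeightOneSpectrum (NumberField.RingOfIntegers K)), ((3 : ℕ) : NumberField.RingOfIntegers K) ∈ 𝔭.asIdeal → 𝔭.asIdeal.ramificationIdx (NumberField.RingOfIntegers ℚ) = 1 → 𝔭.asIdeal.inertiaDeg (NumberField.RingOfIntegers ℚ) = 1 → ∀ (𝔭' : IsDedekindDomain.HeightOneSpectrum (NumberField.RingOfIntegers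 K)), ((3 : ℕ) : NumberField.RingOfIntegers K) ∈ 𝔭'.asIdeal → 𝔭' ≠ 𝔭 → ∀ (ι' : PadicAlgCl 3 ≃+* ℂ), Summit.BirchSwinnertonDyer.BirchSwinnertonDyer.Theorems.SchneiderFree.BranchInducesPrime 3 ι' 𝔭 → ∀ (ΩK : ℂ) (Ωp : ℂ_[3]) (L : Literature.NumberTheory.EllipticCurves.UnrSeries 3), ΩK ≠ 0 → Ωp ≠ 0 → Literature.NumberTheory.EllipticCurves.IsBDPLFunction ι' 𝔭 κ γ Dt.f ΩK Ωp L → Module.IsTorsion (Literature.NumberTheory.EllipticCurves.IwasawaAlgebra 3) (Summit.BirchSwinnertonDyer.Rank1Residual.X11b.AcSelmer.XAc (W.baseChange K) 3 κ 𝔭' ∅ γ) → PowerSeries.constantCoeff L ≠ 0 → (Summit.BirchSwinnertonDyer.Rank1Residual.X11b.AcSelmer.XAc.charIdeal (W.baseChange K) 3 κ 𝔭' ∅ γ).map (PowerSeries.map (Summit.BirchSwinnertonDyer.Rank1Residual.X11b.Halves.toUnr 3)) ≤ Ideal.span {L} := by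
  intro W _ _ N _ K _ _ Dt hO6 hsurj hr1 hN hK hH κ hκ γ _ 𝔭 h𝔭 he hf 𝔭' h𝔭' hne ι' hι ΩK Ωp L hΩK hΩp hL htor hL0
  exact (imcEqualityOffZero_of_kolyvaginInclusion_of_valueAtOne hKo hE1 W N K Dt hO6 hsurj hr1 hN hK hH κ hκ γ 𝔭
    h𝔭 he hf 𝔭' h𝔭' hne ι' hι ΩK Ωp L hΩK hΩp hL htor hL0).le

end Summit.BirchSwinnertonDyer.BirchSwinnertonDyer.Theorems.WildSplitEisensteinInclusionAtThreeValueAtOnePinch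

end
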